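import Summits.QuantumFields.YangMills.Theorems.UnitScaleTiltProp7CovariantOffKernel
import Summits.QuantumFields.YangMills.Theorems.UnitScaleTiltProp7CovCombMeanFrames
import HarnessLib

/-!
# Route `UnitScaleTilt`, crux K1 «MinimiserStabilityRegPr» (stmt-QuantumFields-19200), route-R [RP] at a curved background — THE CURVED N6, ROW (R-B) ⟶ THE S2′ KNIT,
# part 1/2: the operator-norm covariant gradient energy through curl, divergence and curvature, and the scalar bookkeeping of the junction

Cell `ym3-torus`, D-0154 (3c) R3 twin-width seat `ym-routeR-w2` (W-SEAT MAP pass #3 row M9 «(R-B) instantiation + supplier junction»).  THEOREMS ONLY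
(0 `def`, 0 `sorry`); `--supports stmt-QuantumFields-19200`, count-neutral.  YM₃ on T³ is a ladder rung (R3), not the Clay problem; nothing here claims S2,
P, the crux or the gap.

WHERE THIS SITS.  ✓ `Prop7CovIterLambdaHLambda.sum_normSq_covIterLambda_le_T3` (this seat, p616747) bounds `Σ_y‖Λ_k y‖²` by
`[25N·L⁴·E + 2700(3N+6)L⁶·E′]·L^k/(√L−1)²` with `E = (√Σ‖∇^{U₀}Y‖² + C₁εL²L^{−k}√Σ‖Y‖²)²` in the OPERATOR-norm covariant gradient
`∇^{U₀}Y(b,ν) = U₀(b.src,ν)Y(b+ν)U₀(b.src,ν)* − Y(b)`.  The S2′ knit (`Prop7CurvedLandauCoercivity.sum_normSq_le_curl_sq_of_landau_of_structure_T3`, ✓ p601741)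
displays `hΛ : Σ_y‖Λ (K−n) y‖² ≤ cΛ·L^{K−n}·G₀` and spends it against the Hilbert–Schmidt curl form and `L^{−2(K−n)}Σ‖Y‖²`.  Part 2/2
(`Prop7CovIterLambdaHLambdaCurl`) supplies that row; THIS FILE holds its two ingredients:
* §1 `sum_normSq_covGrad_le_covD_HS`, ★ `sum_normSq_covGrad_le_curl_divB` — `Σ‖∇^{U₀}Y‖²_op ≤ CURL_HS + DIV_HS + 2d·a·N·Σ‖Y‖²` for `dist1(U₀(∂p)) ≤ a`
  (op ≤ HS ∘ the quadratic-form Weitzenböck inequality ✓ `Prop7CovariantCoercivity.sum_covD_sq_le_curl_sq_add_divB_sq` ∘ HS ≤ N·op), any `P`, `SU(N)`, level;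
* §2 scalar bookkeeping at `d = 3`, `L ≥ 3`, `2·10⁵·L⁵·ε ≤ 1` (tower run at `2ε`): `√(2·3·L³·2·3) = 6L√L`, `Σ_{j<k}(L^j/L^k)² ≤ 1/8`, `e^x ≤ 23/20 (0 ≤ x ≤ 3/40)`,
  `L^k/(√L−1)² ≤ 2L^k`, `1/(3N) ≤ δ_N`, ★ `rows_rhs_le` (the right-hand side of p616747 at `2ε` is at most
  `L^k·(100·N·L⁴·CD + 10⁹·N²·L⁹·ε·L^{−2k}·SY)` once `g0² ≤ CD + 2d(εL^{−2k})N·SY`).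
HONEST SCOPE.  Bookkeeping over landed theorems; the numerals are crude (no attempt at optimal constants).

References: T. Bałaban, CMP 102 (1985) 277–309 [Balaban1985Variational] ((135) p.298, (14) p.280); CMP 99 (1985) 389–434 [Balaban1985BackgroundPropagators]
((3.3)–(3.10) pp.390–392, Thm 3.11 p.416).
-/

noncomputable section

open scoped BigOperators Matrix.Norms.L2Operator Matrix

namespace Summit.QuantumFields.YangMills.Theorems.Prop7CovIterLambdaHLambdaBridge

open Literature.MathematicalPhysics.QuantumFieldTheory.Balaban1983to89
open Finset ExpMeanLog B1RG242Torus
open B7Eq78Linearization (conjR)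
open B9Eq39Adjoint (covD curl divB)
open B10StarCount (sum_pbond)
open B10Eq27TorusAxialLog (unitsField toUField unitsField_mem_unitaryUnits)
open B9TorusCalculus (torusT)
open Summit.QuantumFields.YangMills.Theorems.Prop7CovariantCoercivity (hyp_of_specialUnitary plaqU_hyp sum_covD_sq_le_curl_sq_add_divB_sq
  sum_norm_sq_le_mul_opNorm_sq)
open Summit.QuantumFields.YangMills.Theorems.Prop7CovCombMeanFrames (conjR_bond_su)

section Lattice

variable {P : Params} {N : ℕ} [NeZero N] {i : ℕ}

/-! ## §1 The covariant gradient energy through curl, divergence and curvature -/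

omit [NeZero N] in
/-- op ≤ HS, bond by bond: `Σ_{b,ν} ‖U₀(b.src,ν)Y(b+ν)U₀(b.src,ν)* − Y(b)‖² ≤ Σ_{x,μ,ν}‖(D_{U₀,ν}Y_μ)(x)‖²_HS` — the covariant gradient energy in the
operator norm is at most the one in the Hilbert–Schmidt norm of the `B9Eq39Adjoint` calculus (`covD`, background `unitsField (toUField U₀)`).
[cite: Balaban1985BackgroundPropagators, (3.3) p.390] -/
theorem sum_normSq_covGrad_le_covD_HS (U₀ : GaugeField P i (Matrix.specialUnitaryGroup (Fin N) ℂ))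
    (Y : PBond P i → Matrix (Fin N) (Fin N) ℂ) :
    ∑ b : PBond P i, ∑ ν : Fin P.d,
        ‖((U₀ ⟨b.src, ν⟩ : Matrix.specialUnitaryGroup (Fin N) ℂ) : Matrix (Fin N) (Fin N) ℂ) * Y ⟨b.src.shift ν, b.dir⟩
            * star ((U₀ ⟨b.src, ν⟩ : Matrix.specialUnitaryGroup (Fin N) ℂ) : Matrix (Fin N) (Fin N) ℂ) - Y b‖ ^ 2
      ≤ ∑ x : Site P i, ∑ μ : Fin P.d, ∑ ν : Fin P.d, ∑ j : Fin N, ∑ k : Fin N,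
          ‖(covD (torusT P i) (fun κ z => unitsField (toUField U₀) ⟨z, κ⟩) ν (fun z => Y ⟨z, μ⟩) x) j k‖ ^ 2 := by
  rw [sum_pbond]
  refine Finset.sum_le_sum fun x _ => Finset.sum_le_sum fun μ _ => Finset.sum_le_sum fun ν _ => ?_
  rw [← conjR_bond_su]
  exact MatrixNorms.opNorm_sq_le_sum_norm_sq _

/-- ★ **THE COVARIANT GRADIENT ENERGY THROUGH CURL, DIVERGENCE AND CURVATURE** (op-norm form of the quadratic-form Weitzenböck inequality
`Prop7CovariantCoercivity.sum_covD_sq_le_curl_sq_add_divB_sq`, [Balaban1985Variational] (135) paired with `Y`): for an `SU(N)` background with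
`dist1(U₀(∂p)) ≤ a` and every bond field `Y`,
`Σ_{b,ν} ‖U₀(b.src,ν)Y(b+ν)U₀(b.src,ν)* − Y(b)‖² ≤ Σ_{x,μ<ν}‖(D_{U₀}Y)(p_{μν}(x))‖²_HS + Σ_x‖(D*_{U₀}Y)(x)‖²_HS + 2d·a·N·Σ_b‖Y(b)‖²`
(op ≤ HS for the gradient, HS ≤ N·op for the zeroth order). [cite: Balaban1985Variational, (135) p.298; Balaban1985BackgroundPropagators, (3.8)-(3.10) p.392] -/
theorem sum_normSq_covGrad_le_curl_divB (U₀ : GaugeField P i (Matrix.specialUnitaryGroup (Fin N) ℂ)) {a : ℝ} (ha : 0 ≤ a)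
    (hU : ∀ p : Plaq P i, dist1 (GaugeField.plaqHol U₀ p) ≤ a) (Y : PBond P i → Matrix (Fin N) (Fin N) ℂ) :
    ∑ b : PBond P i, ∑ ν : Fin P.d,
        ‖((U₀ ⟨b.src, ν⟩ : Matrix.specialUnitaryGroup (Fin N) ℂ) : Matrix (Fin N) (Fin N) ℂ) * Y ⟨b.src.shift ν, b.dir⟩
            * star ((U₀ ⟨b.src, ν⟩ : Matrix.specialUnitaryGroup (Fin N) ℂ) : Matrix (Fin N) (Fin N) ℂ) - Y b‖ ^ 2
      ≤ (∑ x : Site P i, ∑ μ : Fin P.d, ∑ ν : Fin P.d,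
            (if μ < ν then ∑ j : Fin N, ∑ k : Fin N,
              ‖(curl (torusT P i) (fun κ z => unitsField (toUField U₀) ⟨z, κ⟩) (fun κ z => Y ⟨z, κ⟩) μ ν x) j k‖ ^ 2 else 0)
          + ∑ x : Site P i, ∑ j : Fin N, ∑ k : Fin N,
              ‖(divB (torusT P i) (fun κ z => unitsField (toUField U₀) ⟨z, κ⟩) (fun κ z => Y ⟨z, κ⟩) x) j k‖ ^ 2)
        + 2 * P.d * a * (N * ∑ b : PBond P i, ‖Y b‖ ^ 2) := by
  obtain ⟨_, hplaq⟩ := hyp_of_specialUnitary U₀ hU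
  have hVu : ∀ (ν : Fin P.d) (x : Site P i),
      ((fun κ z => unitsField (toUField U₀) ⟨z, κ⟩) ν x : Matrix (Fin N) (Fin N) ℂ) ∈ unitary (Matrix (Fin N) (Fin N) ℂ) :=
    fun ν x => B7Prop2Explicit.mem_unitaryUnits.mp (unitsField_mem_unitaryUnits (toUField U₀) _)
  have hW := sum_covD_sq_le_curl_sq_add_divB_sq hVu (plaqU_hyp ha hplaq) (fun κ z => Y ⟨z, κ⟩)
  have hzero : ∑ x : Site P i, ∑ μ : Fin P.d, ∑ j : Fin N, ∑ k : Fin N, ‖((fun κ z => Y ⟨z, κ⟩) μ x) j k‖ ^ 2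
      ≤ N * ∑ b : PBond P i, ‖Y b‖ ^ 2 := by
    rw [sum_pbond, Finset.mul_sum]
    refine Finset.sum_le_sum fun x _ => ?_
    rw [Finset.mul_sum]
    exact Finset.sum_le_sum fun μ _ => sum_norm_sq_le_mul_opNorm_sq (Y ⟨x, μ⟩)
  have h1 := sum_normSq_covGrad_le_covD_HS U₀ Y
  have h2 := mul_le_mul_of_nonneg_left hzero (by positivity : (0 : ℝ) ≤ 2 * P.d * a)
  linarith


end Lattice

/-! ## §2 Scalar bookkeeping at `d = 3` -/

/-- `√(2·3·L³·2·3) = 6L√L`. [folklore] -/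
theorem sqrt_two_three_cube (L : ℝ) (hL : 0 ≤ L) : Real.sqrt (2 * 3 * L ^ 3 * (2 * 3)) = 6 * L * Real.sqrt L := by
  rw [show (2 : ℝ) * 3 * L ^ 3 * (2 * 3) = (6 * L) ^ 2 * L by ring, Real.sqrt_mul (by positivity) L, Real.sqrt_sq (by positivity)]

/-- `Σ_{j<k} (L^j/L^k)² ≤ 1/8` for `L ≥ 3`. [folklore] -/
theorem sum_range_ratio_sq_le {L : ℕ} (hL : 3 ≤ L) (k : ℕ) :
    ∑ j ∈ range k, ((L : ℝ) ^ j * ((L : ℝ) ^ k)⁻¹) ^ 2 ≤ 1 / 8 := by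
  have hL3 : (3 : ℝ) ≤ L := by exact_mod_cast hL
  obtain ⟨q, hq⟩ : ∃ q : ℝ, q = (L : ℝ) ^ 2 := ⟨_, rfl⟩
  have hq9 : 9 ≤ q := by rw [hq]; nlinarith
  have hq1 : q ≠ 1 := by linarith
  have hQ : 0 < q ^ k := by positivity
  have hpow : ∀ m : ℕ, ((L : ℝ) ^ m) ^ 2 = q ^ m := fun m => by rw [hq, ← pow_mul, mul_comm, pow_mul]
  have hterm : ∀ j ∈ range k, ((L : ℝ) ^ j * ((L : ℝ) ^ k)⁻¹) ^ 2 = q ^ j * (q ^ k)⁻¹ := fun j _ => by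
    rw [mul_pow, inv_pow, hpow, hpow]
  rw [Finset.sum_congr rfl hterm, ← Finset.sum_mul, geom_sum_eq hq1 k]
  have hq1' : 0 < q - 1 := by linarith
  have h8 : q ^ k * 8 ≤ q ^ k * (q - 1) := mul_le_mul_of_nonneg_left (by linarith) hQ.le
  have h1 : (q ^ k - 1) / (q - 1) ≤ q ^ k / 8 := by
    rw [div_le_iff₀ hq1']
    have e : q ^ k / 8 * (q - 1) = q ^ k * (q - 1) / 8 := by ring
    rw [e]
    linarith
  calc (q ^ k - 1) / (q - 1) * (q ^ k)⁻¹ ≤ q ^ k / 8 * (q ^ k)⁻¹ := mul_le_mul_of_nonneg_right h1 (inv_nonneg.mpr hQ.le)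
    _ = 1 / 8 := by field_simp

/-- `e^x ≤ 23/20` for `0 ≤ x ≤ 3/40`. [folklore] -/
theorem exp_le_of_le_three_div_forty {x : ℝ} (hx0 : 0 ≤ x) (hx : x ≤ 3 / 40) : Real.exp x ≤ 23 / 20 := by
  have h := Real.abs_exp_sub_one_le (x := x) (by rw [abs_of_nonneg hx0]; linarith)
  rw [abs_of_nonneg hx0] at h
  have := (abs_le.mp h).2
  linarith

/-- `L^k/(√L − 1)² ≤ 2L^k` for `L ≥ 3`. [folklore] -/
theorem pow_div_sqrt_sub_one_sq_le {L : ℕ} (hL : 3 ≤ L) (k : ℕ) : (L : ℝ) ^ k / (Real.sqrt L - 1) ^ 2 ≤ 2 * (L : ℝ) ^ k := by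
  have hL3 : (3 : ℝ) ≤ L := by exact_mod_cast hL
  have hs : (173 : ℝ) / 100 ≤ Real.sqrt L := by
    rw [show (173 : ℝ) / 100 = Real.sqrt ((173 / 100) ^ 2) from (Real.sqrt_sq (by norm_num)).symm]
    exact Real.sqrt_le_sqrt (by nlinarith)
  have hhalf : (1 : ℝ) / 2 ≤ (Real.sqrt L - 1) ^ 2 := by nlinarith
  have hpos : (0 : ℝ) < (Real.sqrt L - 1) ^ 2 := by linarith
  rw [div_le_iff₀ hpos]
  have hLk : (0 : ℝ) ≤ (L : ℝ) ^ k := by positivity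
  nlinarith [mul_le_mul_of_nonneg_left hhalf hLk]

/-- `1/(3N) ≤ δ_N`. [folklore] -/
theorem one_div_le_deltaSU (N : ℕ) [NeZero N] : 1 / (3 * (N : ℝ)) ≤ deltaSU (Fin N) := by
  have hN : (1 : ℝ) ≤ N := by exact_mod_cast Nat.one_le_iff_ne_zero.mpr (NeZero.ne N)
  have hN0 : (0 : ℝ) < N := by linarith
  rw [deltaSU, Fintype.card_fin]
  refine le_min ?_ ?_
  · exact one_div_le_one_div_of_le (by norm_num) (by linarith)
  · rw [le_div_iff₀ hN0]
    have e : 1 / (3 * (N : ℝ)) * N = 1 / 3 := by field_simp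
    rw [e]
    linarith [Real.pi_gt_three]

/-- ★ **THE SCALAR BOOKKEEPING OF THE JUNCTION** (`d = 3`, `L ≥ 3`, `2·10⁵·L⁵·ε ≤ 1`): the right-hand side of
`Prop7CovIterLambdaHLambda.sum_normSq_covIterLambda_le_T3` run at `2ε`, with `g0² ≤ CD + 2d·(εℓ⁻²)·N·SY` (Weitzenböck) and `M² = SY`, is at most
`ℓ·(100·N·L⁴·CD + 10⁹·N²·L⁹·ε·ℓ⁻²·SY)` (`κ′√L = 4770L³`, `Σ_{j<k}θ_j ≤ 25L²ε/8`, `e_k ≤ 23/20`, `C₁ ≤ 2.5·10⁵L³`, `L^k/(√L−1)² ≤ 2L^k`). [folklore] -/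
theorem rows_rhs_le {d k L N : ℕ} (hd : d = 3) (hL : 3 ≤ L) (hN : 1 ≤ N) {ε g0 M SY CD : ℝ} (hε : 0 < ε)
    (hεL : 2 * 10 ^ 5 * (L : ℝ) ^ 5 * ε ≤ 1) (hM0 : 0 ≤ M) (hMSY : M ^ 2 = SY) (hCD : 0 ≤ CD)
    (hg : g0 ^ 2 ≤ CD + 2 * d * (ε * (((L : ℝ) ^ k) ^ 2)⁻¹) * (N * SY)) :
    (((d : ℝ) + 2) ^ 2 * N * (L : ℝ) ^ 4 * 1
          * (g0 + (154 * Real.sqrt 3 + 25 * Real.sqrt 3 * Real.sqrt L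
                  * (159 * (((d + 2) * L : ℕ) : ℝ) * Real.sqrt (2 * d * (L : ℝ) ^ d * (2 * d)))
                  * Real.exp ((159 * (((d + 2) * L : ℕ) : ℝ) * Real.sqrt (2 * d * (L : ℝ) ^ d * (2 * d))) / (Real.sqrt L)⁻¹
                      * ∑ j ∈ range k, (((d + 2) * L : ℕ) : ℝ) ^ 2 / 4 * (2 * (2 * ε) * ((L : ℝ) ^ j * ((L : ℝ) ^ k)⁻¹) ^ 2)))
                * (2 * ε) * (L : ℝ) ^ 2 * ((L : ℝ) ^ k)⁻¹ * M) ^ 2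
        + 4 * ((d : ℝ) + 2) ^ 2 * (d : ℝ) ^ 3 * (3 * N + 2 * d) * (L : ℝ) ^ 6 * 1
          * (4 * (2 * ε) ^ 2 * (((L : ℝ) ^ k)⁻¹) ^ 2
            * Real.exp ((159 * (((d + 2) * L : ℕ) : ℝ) * Real.sqrt (2 * d * (L : ℝ) ^ d * (2 * d))) / (Real.sqrt L)⁻¹
                * ∑ j ∈ range k, (((d + 2) * L : ℕ) : ℝ) ^ 2 / 4 * (2 * (2 * ε) * ((L : ℝ) ^ j * ((L : ℝ) ^ k)⁻¹) ^ 2)) ^ 2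
            * SY))
      * ((L : ℝ) ^ k / (Real.sqrt L - 1) ^ 2)
    ≤ (L : ℝ) ^ k * (100 * N * (L : ℝ) ^ 4 * CD + 10 ^ 9 * N ^ 2 * (L : ℝ) ^ 9 * ε * (((L : ℝ) ^ k) ^ 2)⁻¹ * SY) := by
  subst hd
  have hc5 : (((3 + 2) * L : ℕ) : ℝ) = 5 * L := by push_cast; ring
  simp only [hc5, Nat.cast_ofNat] at hg ⊢
  have hL3 : (3 : ℝ) ≤ L := by exact_mod_cast hL
  have hL0 : (0 : ℝ) < L := by linarith
  have hN1 : (1 : ℝ) ≤ N := by exact_mod_cast hN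
  have hSY : 0 ≤ SY := by rw [← hMSY]; exact sq_nonneg _
  -- names
  obtain ⟨s, hs⟩ : ∃ s : ℝ, s = Real.sqrt L := ⟨_, rfl⟩
  obtain ⟨ℓ, hℓ⟩ : ∃ ℓ : ℝ, ℓ = (L : ℝ) ^ k := ⟨_, rfl⟩
  obtain ⟨A, hA⟩ : ∃ A : ℝ, A = ∑ j ∈ range k, (5 * (L : ℝ)) ^ 2 / 4 * (2 * (2 * ε) * ((L : ℝ) ^ j * ((L : ℝ) ^ k)⁻¹) ^ 2) := ⟨_, rfl⟩
  obtain ⟨κ, hκ⟩ : ∃ κ : ℝ, κ = 159 * (5 * (L : ℝ)) * Real.sqrt (2 * 3 * (L : ℝ) ^ 3 * (2 * 3)) := ⟨_, rfl⟩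
  obtain ⟨ek, hek⟩ : ∃ ek : ℝ, ek = Real.exp (κ / s⁻¹ * A) := ⟨_, rfl⟩
  rw [← hs, ← hA, ← hκ, ← hek, ← hℓ]
  -- scalar facts
  have hs0 : 0 < s := by rw [hs]; exact Real.sqrt_pos.mpr hL0
  have hs2 : s ^ 2 = L := by rw [hs]; exact Real.sq_sqrt hL0.le
  have hℓ0 : 0 < ℓ := by rw [hℓ]; positivity
  have hκe : κ = 4770 * (L : ℝ) ^ 2 * s := by rw [hκ, sqrt_two_three_cube _ hL0.le, ← hs]; ring
  have hκs : κ / s⁻¹ = 4770 * (L : ℝ) ^ 3 := by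
    rw [div_inv_eq_mul, hκe, show (4770 : ℝ) * L ^ 2 * s * s = 4770 * L ^ 2 * s ^ 2 by ring, hs2]; ring
  have hsκ : s * κ = 4770 * (L : ℝ) ^ 3 := by
    rw [hκe, show s * ((4770 : ℝ) * L ^ 2 * s) = 4770 * L ^ 2 * s ^ 2 by ring, hs2]; ring
  have hAle : A ≤ 25 * (L : ℝ) ^ 2 * ε / 8 := by
    have e : A = 25 * (L : ℝ) ^ 2 * ε * ∑ j ∈ range k, ((L : ℝ) ^ j * ((L : ℝ) ^ k)⁻¹) ^ 2 := by
      rw [hA, Finset.mul_sum]; exact Finset.sum_congr rfl fun j _ => by ring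
    rw [e]
    have := mul_le_mul_of_nonneg_left (sum_range_ratio_sq_le hL k) (by positivity : (0 : ℝ) ≤ 25 * (L : ℝ) ^ 2 * ε)
    linarith
  have hA0 : 0 ≤ A := by rw [hA]; exact Finset.sum_nonneg fun j _ => by positivity
  have hL5ε : (L : ℝ) ^ 5 * ε ≤ 1 / 200000 := by linarith
  have hx : κ / s⁻¹ * A ≤ 3 / 40 := by
    rw [hκs]
    have := mul_le_mul_of_nonneg_left hAle (by positivity : (0 : ℝ) ≤ 4770 * (L : ℝ) ^ 3)
    have e : (4770 : ℝ) * L ^ 3 * (25 * L ^ 2 * ε / 8) = 119250 / 8 * (L ^ 5 * ε) := by ring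
    rw [e] at this
    linarith
  have hx0 : 0 ≤ κ / s⁻¹ * A := by rw [hκs]; positivity
  have hek1 : ek ≤ 23 / 20 := by rw [hek]; exact exp_le_of_le_three_div_forty hx0 hx
  have hek0 : 0 ≤ ek := by rw [hek]; exact (Real.exp_pos _).le
  have h3 : Real.sqrt 3 ≤ 7 / 4 := by rw [Real.sqrt_le_left (by norm_num)]; norm_num
  have h30 : 0 ≤ Real.sqrt 3 := Real.sqrt_nonneg _
  -- `C₁ ≤ 2.5·10⁵·L³`
  have hC1 : 154 * Real.sqrt 3 + 25 * Real.sqrt 3 * s * κ * ek ≤ 250000 * (L : ℝ) ^ 3 := by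
    have e : 25 * Real.sqrt 3 * s * κ * ek = Real.sqrt 3 * (119250 * (L : ℝ) ^ 3) * ek := by
      rw [show 25 * Real.sqrt 3 * s * κ * ek = Real.sqrt 3 * (25 * (s * κ)) * ek by ring, hsκ]; ring
    rw [e]
    have hL31 : (1 : ℝ) ≤ (L : ℝ) ^ 3 := one_le_pow₀ (by linarith)
    have t1 : Real.sqrt 3 * (119250 * (L : ℝ) ^ 3) * ek ≤ 7 / 4 * (119250 * (L : ℝ) ^ 3) * (23 / 20) :=
      mul_le_mul (mul_le_mul_of_nonneg_right h3 (by positivity)) hek1 hek0 (by positivity)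
    have t2 : Real.sqrt 3 ≤ 7 / 4 * (L : ℝ) ^ 3 := h3.trans (le_mul_of_one_le_right (by norm_num) hL31)
    linarith only [t1, t2, hL31]
  have hC10 : 0 ≤ 154 * Real.sqrt 3 + 25 * Real.sqrt 3 * s * κ * ek := by
    rw [hκe]; positivity
  -- the gradient square
  have hT : (154 * Real.sqrt 3 + 25 * Real.sqrt 3 * s * κ * ek) * (2 * ε) * (L : ℝ) ^ 2 * ℓ⁻¹ * M
      ≤ 500000 * (L : ℝ) ^ 5 * ε * ℓ⁻¹ * M := by
    have := mul_le_mul_of_nonneg_right hC1 (by positivity : (0 : ℝ) ≤ (2 * ε) * (L : ℝ) ^ 2 * ℓ⁻¹ * M)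
    have e1 : (154 * Real.sqrt 3 + 25 * Real.sqrt 3 * s * κ * ek) * (2 * ε) * (L : ℝ) ^ 2 * ℓ⁻¹ * M
        = (154 * Real.sqrt 3 + 25 * Real.sqrt 3 * s * κ * ek) * ((2 * ε) * (L : ℝ) ^ 2 * ℓ⁻¹ * M) := by ring
    have e2 : (500000 : ℝ) * L ^ 5 * ε * ℓ⁻¹ * M = 250000 * (L : ℝ) ^ 3 * ((2 * ε) * (L : ℝ) ^ 2 * ℓ⁻¹ * M) := by ring
    rw [e1, e2]; exact this
  have hT0 : 0 ≤ (154 * Real.sqrt 3 + 25 * Real.sqrt 3 * s * κ * ek) * (2 * ε) * (L : ℝ) ^ 2 * ℓ⁻¹ * M := by positivity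
  have hT2 : ((154 * Real.sqrt 3 + 25 * Real.sqrt 3 * s * κ * ek) * (2 * ε) * (L : ℝ) ^ 2 * ℓ⁻¹ * M) ^ 2
      ≤ 2500000 * (L : ℝ) ^ 5 * (ε * (ℓ ^ 2)⁻¹ * SY) / 2 := by
    refine (pow_le_pow_left₀ hT0 hT 2).trans ?_
    have e : ((500000 : ℝ) * L ^ 5 * ε * ℓ⁻¹ * M) ^ 2 = 250000000000 * (L ^ 5 * ε) * (L ^ 5 * (ε * (ℓ ^ 2)⁻¹ * SY)) := by
      rw [← hMSY]; field_simp; ring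
    rw [e]
    have := mul_le_mul_of_nonneg_right hL5ε (by positivity : (0 : ℝ) ≤ L ^ 5 * (ε * (ℓ ^ 2)⁻¹ * SY))
    linarith only [this]
  have hsq : (g0 + (154 * Real.sqrt 3 + 25 * Real.sqrt 3 * s * κ * ek) * (2 * ε) * (L : ℝ) ^ 2 * ℓ⁻¹ * M) ^ 2
      ≤ 2 * CD + (12 * N + 2500000 * (L : ℝ) ^ 5) * (ε * (ℓ ^ 2)⁻¹ * SY) := by
    have hadd : ∀ a b : ℝ, (a + b) ^ 2 ≤ 2 * a ^ 2 + 2 * b ^ 2 := fun a b => by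
      linarith only [sq_nonneg (a - b), add_sq a b, sub_sq a b]
    refine (hadd _ _).trans ?_
    have hg' : g0 ^ 2 ≤ CD + 6 * N * (ε * (ℓ ^ 2)⁻¹ * SY) := by rw [hℓ]; linarith only [hg]
    linarith only [hg', hT2]
  -- the `E′` row
  have hw0 : 0 ≤ ε * (ℓ ^ 2)⁻¹ * SY := by positivity
  have hε1 : ε ≤ 1 := by
    have h1 : (1 : ℝ) ≤ (L : ℝ) ^ 5 := one_le_pow₀ (by linarith)
    have := mul_le_mul_of_nonneg_right h1 hε.le
    linarith only [this, hL5ε]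
  have hE' : 4 * (2 * ε) ^ 2 * (ℓ⁻¹) ^ 2 * ek ^ 2 * SY ≤ 22 * (ε * (ℓ ^ 2)⁻¹ * SY) := by
    have hek2 : ek ^ 2 ≤ (23 / 20) ^ 2 := pow_le_pow_left₀ hek0 hek1 2
    have hε2 : ε ^ 2 ≤ ε := by
      have h := mul_le_mul_of_nonneg_left hε1 hε.le
      rw [mul_one] at h; rw [sq]; exact h
    rw [inv_pow]
    have h1 := mul_le_mul hε2 hek2 (sq_nonneg _) hε.le
    have h2 := mul_le_mul_of_nonneg_right h1 (by positivity : (0 : ℝ) ≤ (ℓ ^ 2)⁻¹ * SY)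
    linarith only [h2, hw0]
  -- monomial comparisons
  have hL1 : (1 : ℝ) ≤ L := by linarith
  have hL49 : (L : ℝ) ^ 4 ≤ (L : ℝ) ^ 9 := pow_le_pow_right₀ hL1 (by norm_num)
  have hL69 : (L : ℝ) ^ 6 ≤ (L : ℝ) ^ 9 := pow_le_pow_right₀ hL1 (by norm_num)
  have hNN : (N : ℝ) ≤ (N : ℝ) ^ 2 := by rw [sq]; exact le_mul_of_one_le_left (by positivity) hN1
  have m1 : (N : ℝ) ^ 2 * (L : ℝ) ^ 4 * (ε * (ℓ ^ 2)⁻¹ * SY) ≤ (N : ℝ) ^ 2 * (L : ℝ) ^ 9 * (ε * (ℓ ^ 2)⁻¹ * SY) :=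
    mul_le_mul_of_nonneg_right (mul_le_mul_of_nonneg_left hL49 (sq_nonneg _)) hw0
  have m2 : (N : ℝ) * (L : ℝ) ^ 9 * (ε * (ℓ ^ 2)⁻¹ * SY) ≤ (N : ℝ) ^ 2 * (L : ℝ) ^ 9 * (ε * (ℓ ^ 2)⁻¹ * SY) :=
    mul_le_mul_of_nonneg_right (mul_le_mul_of_nonneg_right hNN (by positivity)) hw0
  have m3 : (N : ℝ) * (L : ℝ) ^ 6 * (ε * (ℓ ^ 2)⁻¹ * SY) ≤ (N : ℝ) ^ 2 * (L : ℝ) ^ 9 * (ε * (ℓ ^ 2)⁻¹ * SY) :=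
    mul_le_mul_of_nonneg_right (mul_le_mul hNN hL69 (by positivity) (by positivity)) hw0
  -- the two rows
  have hX : ((3 : ℝ) + 2) ^ 2 * N * (L : ℝ) ^ 4 * 1
        * (g0 + (154 * Real.sqrt 3 + 25 * Real.sqrt 3 * s * κ * ek) * (2 * ε) * (L : ℝ) ^ 2 * ℓ⁻¹ * M) ^ 2
      ≤ 25 * N * (L : ℝ) ^ 4 * (2 * CD + (12 * N + 2500000 * (L : ℝ) ^ 5) * (ε * (ℓ ^ 2)⁻¹ * SY)) := by
    have := mul_le_mul_of_nonneg_left hsq (by positivity : (0 : ℝ) ≤ 25 * N * (L : ℝ) ^ 4)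
    have e : ((3 : ℝ) + 2) ^ 2 * N * (L : ℝ) ^ 4 * 1 = 25 * N * (L : ℝ) ^ 4 := by ring
    rw [e]; exact this
  have hX' : 4 * ((3 : ℝ) + 2) ^ 2 * (3 : ℝ) ^ 3 * (3 * N + 2 * 3) * (L : ℝ) ^ 6 * 1
        * (4 * (2 * ε) ^ 2 * (ℓ⁻¹) ^ 2 * ek ^ 2 * SY) ≤ 2700 * (9 * N) * (L : ℝ) ^ 6 * (22 * (ε * (ℓ ^ 2)⁻¹ * SY)) := by
    have h9 : (3 : ℝ) * N + 2 * 3 ≤ 9 * N := by linarith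
    have h0 : 0 ≤ 4 * (2 * ε) ^ 2 * (ℓ⁻¹) ^ 2 * ek ^ 2 * SY := by positivity
    have := mul_le_mul (mul_le_mul_of_nonneg_right (mul_le_mul_of_nonneg_left h9 (by norm_num : (0 : ℝ) ≤ 2700)) (by positivity))
      hE' h0 (by positivity : (0 : ℝ) ≤ 2700 * (9 * N) * (L : ℝ) ^ 6)
    have e : 4 * ((3 : ℝ) + 2) ^ 2 * (3 : ℝ) ^ 3 * (3 * N + 2 * 3) * (L : ℝ) ^ 6 * 1 = 2700 * (3 * N + 2 * 3) * (L : ℝ) ^ 6 := by ring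
    rw [e]; exact this
  have hsum : ((3 : ℝ) + 2) ^ 2 * N * (L : ℝ) ^ 4 * 1
        * (g0 + (154 * Real.sqrt 3 + 25 * Real.sqrt 3 * s * κ * ek) * (2 * ε) * (L : ℝ) ^ 2 * ℓ⁻¹ * M) ^ 2
      + 4 * ((3 : ℝ) + 2) ^ 2 * (3 : ℝ) ^ 3 * (3 * N + 2 * 3) * (L : ℝ) ^ 6 * 1
        * (4 * (2 * ε) ^ 2 * (ℓ⁻¹) ^ 2 * ek ^ 2 * SY)
      ≤ 50 * N * (L : ℝ) ^ 4 * CD + 64000000 * (N : ℝ) ^ 2 * (L : ℝ) ^ 9 * (ε * (ℓ ^ 2)⁻¹ * SY) := by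
    have hw9 : 0 ≤ (N : ℝ) ^ 2 * (L : ℝ) ^ 9 * (ε * (ℓ ^ 2)⁻¹ * SY) := by positivity
    linarith only [hX, hX', m1, m2, m3, hw9]
  have hpos : 0 ≤ ((3 : ℝ) + 2) ^ 2 * N * (L : ℝ) ^ 4 * 1
        * (g0 + (154 * Real.sqrt 3 + 25 * Real.sqrt 3 * s * κ * ek) * (2 * ε) * (L : ℝ) ^ 2 * ℓ⁻¹ * M) ^ 2
      + 4 * ((3 : ℝ) + 2) ^ 2 * (3 : ℝ) ^ 3 * (3 * N + 2 * 3) * (L : ℝ) ^ 6 * 1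
        * (4 * (2 * ε) ^ 2 * (ℓ⁻¹) ^ 2 * ek ^ 2 * SY) := by positivity
  have hfrac : ℓ / (s - 1) ^ 2 ≤ 2 * ℓ := by rw [hℓ, hs]; exact pow_div_sqrt_sub_one_sq_le hL k
  have hfrac0 : 0 ≤ ℓ / (s - 1) ^ 2 := by positivity
  have hfin := mul_le_mul hsum hfrac hfrac0 (by positivity)
  refine hfin.trans ?_
  have hR0 : 0 ≤ (N : ℝ) ^ 2 * (L : ℝ) ^ 9 * (ε * (ℓ ^ 2)⁻¹ * SY) := by positivity
  have hC0 : 0 ≤ (N : ℝ) * (L : ℝ) ^ 4 * CD := by positivity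
  linarith only [mul_nonneg hℓ0.le hR0, mul_nonneg hℓ0.le hC0]

end Summit.QuantumFields.YangMills.Theorems.Prop7CovIterLambdaHLambdaBridge

end
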